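import Literature.MathematicalPhysics.QuantumLattice.HubbardTorusMarkovPressureBound
import Literature.MathematicalPhysics.QuantumLattice.HubbardAndersonClusterBound
import HarnessLib

/-!
# Weighted-cluster (bond) energy representatives of the Hubbard torus Hamiltonian in
# translation-invariant states, and the structured annihilator of local consistency

Topic `MathematicalPhysics/QuantumLattice`, namespace `Literature.MathematicalPhysics.QuantumLattice`.

For the pure Hubbard model on the `d`-dimensional torus `(ℤ/Lℤ)^d` (`hubbardTorus d L t U`,
`hubbardTorusWith d L t U μ = H − μN`; `L ≥ 3`) and a finite window `Λ ⊆ ℤ^d` fitting into the torus: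

* §1 `hubbardTorus_eq_kinetic_bond_sum` — the public form of the bond decomposition
  `H = −t Σ_i Σ_w K_{w,i} + U Σ_w n_{w↑}n_{w↓}` (the copy in `HubbardAndersonClusterBound.lean` is private),
  and `sum_relabel_translate_clusterHamiltonian_eq_hubbardTorusWith`: the torus translates of a weighted
  open cluster `h(J,V,μ')` (`AndersonCluster.clusterHamiltonian`) with NORMALISED weights — bond weights
  summing to `1` in every direction, interaction weights summing to `1`, potential weights summing to `−μ` —
  sum to `H − μN` [cite: Anderson1951, eq. (2)];
* §2 `torus_trace_mul_sum_relabel_translate`, `torus_trace_fermionPartialTrace_mul_translate_eq` (any `d`;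
  the `d = 2` statements are in `HubbardTorusMarkovPressureBound.lean`) and the ENERGY IDENTITY
  `trace_mul_hubbardTorusWith_eq_cluster`: `tr(ρ (H − μN)) = L^d · tr(ρ_Λ h(J,V,μ'))` for every
  translation-invariant torus state `ρ` — the local energy representative of the Markov pressure
  certificate (`torus_log_partitionFn_le_of_certificate`, hypothesis `hKh`) for windows as small as a
  corner `{a, a − e₁, …, a − e_d}` (the programme's `h_μ = U n_{a↑}n_{a↓} − μ n_a − t Σ_i hop(a − eᵢ, a)`,
  `hubbard-thermal` certificate C1, is the case of weights concentrated at the corner);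
* §3 hermiticity of weighted clusters (`isHermitian_clusterHamiltonian`) and the structured ANNIHILATOR
  `windowAnnihilator` = `Σ_i g_i (Γ O_i − Γ τ_{z_i} O_i)` (the multipliers of local consistency
  [cite: PoulinHastings2011, eqs. (3)–(8)]): Hermitian, and of zero expectation in every
  translation-invariant state (`trace_window_mul_windowAnnihilator`).

Everything is PROVED; `windowAnnihilator` is bookkeeping (a finite sum of given local operators); no named
fact. Consumer: `HubbardTorusMarkovPressureClusterBound.lean` (the certified pressure bound with a
weighted-cluster representative).
-/

noncomputable section

namespace Literature.MathematicalPhysics.QuantumLattice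

open Matrix Finset HubbardWave0 Literature.Probability.LatticeModels AndersonCluster
open scoped ComplexOrder

/-! ### §1. The torus Hubbard Hamiltonian as a sum over bonds; normalised weighted clusters -/

section Torus

variable {d L : ℕ} [NeZero L]

/-- (Local to this file, as in `HubbardAndersonClusterBound.lean`.) Equality of torus sites is decided through
the linear order — the instance the generic Jordan–Wigner lemmas carry. [folklore] -/
local instance (priority := high) instDecidableEqFermionTorusClusterRep : DecidableEq (FermionTorus d L) :=
  LinearOrder.toDecidableEq

/-- `|(ℤ/Lℤ)^d| = L^d`. [folklore] -/
private theorem card_torusSite_pow : Fintype.card (TorusSite d L) = L ^ d := by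
  simp [ZMod.card, Fintype.card_fin]

/-- `Σ_w (n_{w↑} + n_{w↓}) = N̂` on the torus. [cite: Tasaki2020, §10.1] -/
theorem sum_torusDensity_eq_totalNumber :
    ∑ w : TorusSite d L, torusDensity w =
      (totalNumber : Matrix (Finset (Orb (FermionTorus d L))) (Finset (Orb (FermionTorus d L))) ℂ) := by
  rw [totalNumber]
  rw [← Fintype.sum_equiv FermionTorus.equivTorusSite.symm (fun w => torusDensity w)
    (fun x : FermionTorus d L => ∑ σ : Fin 2, numberOp x σ) (fun w => ?_)]
  rw [Fin.sum_univ_two]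
  rfl

/-- The torus Hubbard Hamiltonian as a sum over sites and directions, `L ≥ 3`:
`H = -t Σ_w Σ_i Σ_σ (c†_w c_{w+eᵢ} + c†_w c_{w-eᵢ}) + U Σ_w n_{w↑}n_{w↓}`. [folklore] -/
private theorem hubbardTorus_eq_sum_torusSite' (t U : ℝ) (hL : 3 ≤ L) :
    hubbardTorus d L t U =
      -(t : ℂ) • (∑ v : TorusSite d L, ∑ i : Fin d, ∑ σ : Fin 2,
          (creation (orb (FermionTorus.ofTorusSite v) σ) *
              annihilation (orb (FermionTorus.ofTorusSite (v + Pi.single i 1)) σ) +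
            creation (orb (FermionTorus.ofTorusSite v) σ) *
              annihilation (orb (FermionTorus.ofTorusSite (v - Pi.single i 1)) σ))) +
        (U : ℂ) • ∑ v : TorusSite d L, torusDoubleOcc v := by
  set o : TorusSite d L → FermionTorus d L := FermionTorus.ofTorusSite with ho
  rw [hubbardTorus, hamiltonian]
  congr 1
  · congr 1
    rw [← Fintype.sum_equiv FermionTorus.equivTorusSite.symm
      (fun v : TorusSite d L => ∑ i : Fin d, ∑ σ : Fin 2,
        (creation (orb (o v) σ) * annihilation (orb (o (v + Pi.single i 1)) σ) +
          creation (orb (o v) σ) * annihilation (orb (o (v - Pi.single i 1)) σ))) _ (fun v => ?_)]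
    rw [← Fintype.sum_equiv FermionTorus.equivTorusSite.symm
      (fun w : TorusSite d L => ∑ σ : Fin 2,
        if (fermionTorusGraph d L).Adj (FermionTorus.equivTorusSite.symm v) (o w) then
          creation (orb (FermionTorus.equivTorusSite.symm v) σ) * annihilation (orb (o w) σ) else 0)
      _ (fun w => rfl)]
    have hv : (FermionTorus.equivTorusSite.symm v : FermionTorus d L) = o v := rfl
    simp_rw [hv]
    have hadj : ∀ w : TorusSite d L, (fermionTorusGraph d L).Adj (o v) (o w) ↔ (torusGraph d L).Adj v w := by
      intro w
      rw [fermionTorusGraph_adj, ho, FermionTorus.toTorusSite_ofTorusSite, FermionTorus.toTorusSite_ofTorusSite]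
    have hite : ∀ w : TorusSite d L, (∑ σ : Fin 2,
        if (fermionTorusGraph d L).Adj (o v) (o w) then creation (orb (o v) σ) * annihilation (orb (o w) σ) else 0) =
        if (torusGraph d L).Adj v w then ∑ σ : Fin 2, creation (orb (o v) σ) * annihilation (orb (o w) σ) else 0 := by
      intro w
      by_cases h : (torusGraph d L).Adj v w
      · rw [if_pos h]
        exact Finset.sum_congr rfl fun σ _ => by rw [if_pos ((hadj _).2 h)]
      · rw [if_neg h]
        exact Finset.sum_eq_zero fun σ _ => by rw [if_neg (fun h' => h ((hadj _).1 h'))]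
    simp_rw [hite]
    rw [sum_ite_torusGraph_adj_matrix hL v]
    simp only [Finset.sum_add_distrib]
  · congr 1
    exact (Fintype.sum_equiv FermionTorus.equivTorusSite.symm (fun v => torusDoubleOcc v)
      (fun x : FermionTorus d L => numberOp x 0 * numberOp x 1) fun v => rfl).symm

/-- **The torus Hubbard Hamiltonian as a sum over bonds**, `L ≥ 3`:
`H = -t Σ_i Σ_w Σ_σ (c†_w c_{w+eᵢ} + c†_{w+eᵢ} c_w) + U Σ_w n_{w↑}n_{w↓}` (public form of the private
`hubbardTorus_eq_sum_torusBondKinetic` of `HubbardAndersonClusterBound.lean`). [cite: LiebPRL1989, eq. (1)] -/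
theorem hubbardTorus_eq_kinetic_bond_sum (t U : ℝ) (hL : 3 ≤ L) :
    hubbardTorus d L t U =
      -(t : ℂ) • (∑ i : Fin d, ∑ w : TorusSite d L, torusBondKinetic w i) +
        (U : ℂ) • ∑ w : TorusSite d L, torusDoubleOcc w := by
  rw [hubbardTorus_eq_sum_torusSite' t U hL]
  congr 2
  rw [Finset.sum_comm]
  refine Finset.sum_congr rfl fun i _ => ?_
  simp only [Finset.sum_add_distrib]
  have hshift : ∑ v : TorusSite d L, ∑ σ : Fin 2,
      creation (orb (FermionTorus.ofTorusSite v) σ) *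
        annihilation (orb (FermionTorus.ofTorusSite (v - Pi.single i 1)) σ) =
      ∑ v : TorusSite d L, ∑ σ : Fin 2,
        creation (orb (FermionTorus.ofTorusSite (v + Pi.single i 1)) σ) *
          annihilation (orb (FermionTorus.ofTorusSite v) σ) :=
    TorusSite.sum_sub_shift (Pi.single i 1)
      (fun a b => ∑ σ : Fin 2, creation (orb (FermionTorus.ofTorusSite a) σ) *
        annihilation (orb (FermionTorus.ofTorusSite b) σ))
  rw [hshift, ← Finset.sum_add_distrib]
  refine Finset.sum_congr rfl fun v _ => ?_
  rw [torusBondKinetic, ← Finset.sum_add_distrib]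

/-- **The translates of a NORMALISED weighted cluster sum to `H − μ N`.** For `L ≥ 3`, a window `Λ`
on which `x ↦ x mod L` is injective, and weights with `Σ_x J̃(x,i) = 1` for every direction `i`
(`bondWeightSum`), `Σ_x V x = 1` and `Σ_x μ' x = −μ`:
`Σ_v T_v Γ(ι) h(J,V,μ') T_v⁻¹ = H_L(t,U) − μ N_L` (`hubbardTorusWith`). [cite: Anderson1951, eq. (2)] -/
theorem sum_relabel_translate_clusterHamiltonian_eq_hubbardTorusWith (hL : 3 ≤ L) {Λ : Finset (Site d)}
    (hT : Set.InjOn (Torus.proj (d := d) L) ↑Λ) (t U μ : ℝ) {J : Site d → Fin d → ℝ} {V μ' : Site d → ℝ}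
    (hJ : ∀ i, bondWeightSum Λ J i = 1) (hV : siteWeightSum Λ V = 1) (hμ : siteWeightSum Λ μ' = -μ) :
    ∑ v : TorusSite d L, relabel (Orb.translate v)
        (fermionEmbed (PolySite.toTorusEmb L hT) (clusterHamiltonian Λ t U J V μ')) =
      hubbardTorusWith d L t U μ := by
  rw [sum_relabel_translate_clusterHamiltonian hT t U J V μ', hubbardTorusWith, hamiltonianWith_eq, ← hubbardTorus,
    hubbardTorus_eq_kinetic_bond_sum t U hL, hV, hμ, mul_one]
  simp_rw [hJ]
  simp only [Complex.ofReal_one, one_smul, Complex.ofReal_neg, neg_smul]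
  rw [sub_eq_add_neg]

/-! ### §2. Translation-invariant torus states: the energy identity for a weighted cluster -/

/-- **The expectation of a translation sum** in a translation-invariant state of the `d`-torus is `L^d`
times the expectation of one term (the `d = 2` statement is `trace_mul_sum_relabel_translate`).
[cite: BratteliRobinsonI1987, §4.3.1] -/
theorem torus_trace_mul_sum_relabel_translate
    {ρ : Matrix (Finset (Orb (FermionTorus d L))) (Finset (Orb (FermionTorus d L))) ℂ}
    (hTI : ∀ w : TorusSite d L, relabel (Orb.translate w) ρ = ρ)
    (X : Matrix (Finset (Orb (FermionTorus d L))) (Finset (Orb (FermionTorus d L))) ℂ) :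
    (ρ * ∑ v : TorusSite d L, relabel (Orb.translate v) X).trace = ((L : ℂ) ^ d) * (ρ * X).trace := by
  rw [Matrix.mul_sum, Matrix.trace_sum]
  simp_rw [trace_mul_relabel_of_invariant (Orb.translate _) (hTI _) X]
  rw [Finset.sum_const, Finset.card_univ, card_torusSite_pow, nsmul_eq_mul, Nat.cast_pow]

/-- **Translation-related local observables have equal expectation** in a translation-invariant state
of the `d`-torus: for a region `Ω` fitting into the torus, `A ∈ 𝔄_{Λ₁}` with `Λ₁ ⊆ Ω` and `Λ₁ + z ⊆ Ω`,
`tr(ρ_Ω · Γ(incl)(Γ(τ_z) A)) = tr(ρ_Ω · Γ(incl) A)` (the `d = 2` statement is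
`trace_fermionPartialTrace_mul_translate_eq`). [cite: ArakiMoriya2003, §4.1 Def. 4.3 and Def. 4.5] -/
theorem torus_trace_fermionPartialTrace_mul_translate_eq
    {ρ : Matrix (Finset (Orb (FermionTorus d L))) (Finset (Orb (FermionTorus d L))) ℂ}
    (hTI : ∀ w : TorusSite d L, relabel (Orb.translate w) ρ = ρ)
    {Ω Λ₁ : Finset (Site d)} (hΩ : Set.InjOn (Torus.proj (d := d) L) ↑Ω) (h₁ : Λ₁ ⊆ Ω) (z : Site d)
    (hz : shiftSet z Λ₁ ⊆ Ω) (A : FermionOp Λ₁) :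
    (fermionPartialTrace (PolySite.toTorusEmb L hΩ) ρ *
        fermionEmbed (PolySite.incl hz) (fermionEmbed (PolySite.shiftEmb z Λ₁) A)).trace =
      (fermionPartialTrace (PolySite.toTorusEmb L hΩ) ρ * fermionEmbed (PolySite.incl h₁) A).trace := by
  have hΛ₁ : Set.InjOn (Torus.proj (d := d) L) ↑Λ₁ := hΩ.mono (Finset.coe_subset.2 h₁)
  have e1 : (PolySite.incl h₁).trans (PolySite.toTorusEmb L hΩ) = PolySite.toTorusEmb L hΛ₁ :=
    DFunLike.ext _ _ fun _ => rfl
  rw [Matrix.trace_mul_comm, trace_mul_fermionPartialTrace, ← relabel_translate_proj_fermionEmbed L hΩ hΛ₁ z hz A,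
    Matrix.trace_mul_comm, trace_mul_relabel_of_invariant _ (hTI _),
    Matrix.trace_mul_comm (fermionPartialTrace _ ρ), trace_mul_fermionPartialTrace, fermionEmbed_fermionEmbed, e1,
    Matrix.trace_mul_comm]

/-- **The energy identity for a weighted-cluster representative.** For `L ≥ 3`, a translation-invariant
torus state `ρ`, a window `Λ` fitting into the torus and NORMALISED weights (`Σ J̃(·,i) = 1` for every
direction, `Σ V = 1`, `Σ μ' = −μ`):
`tr(ρ (H_L(t,U) − μ N_L)) = L^d · tr(ρ_Λ · h(J,V,μ'))` with `ρ_Λ = tr_{𝕋→Λ} ρ` and `h = clusterHamiltonian`.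
This is the hypothesis `hKh` of `torus_log_partitionFn_le_of_certificate` for windows as small as a corner
`{a, a − e₁, …, a − e_d}`. [cite: BratteliRobinsonII1997, §6.2.4] [cite: Anderson1951, eq. (2)] -/
theorem trace_mul_hubbardTorusWith_eq_cluster (hL : 3 ≤ L) (t U μ : ℝ)
    {ρ : Matrix (Finset (Orb (FermionTorus d L))) (Finset (Orb (FermionTorus d L))) ℂ}
    (hTI : ∀ w : TorusSite d L, relabel (Orb.translate w) ρ = ρ)
    {Λ : Finset (Site d)} (hT : Set.InjOn (Torus.proj (d := d) L) ↑Λ)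
    {J : Site d → Fin d → ℝ} {V μ' : Site d → ℝ}
    (hJ : ∀ i, bondWeightSum Λ J i = 1) (hV : siteWeightSum Λ V = 1) (hμ : siteWeightSum Λ μ' = -μ) :
    (ρ * hubbardTorusWith d L t U μ).trace =
      ((L : ℂ) ^ d) * (fermionPartialTrace (PolySite.toTorusEmb L hT) ρ * clusterHamiltonian Λ t U J V μ').trace := by
  rw [← sum_relabel_translate_clusterHamiltonian_eq_hubbardTorusWith hL hT t U μ hJ hV hμ,
    torus_trace_mul_sum_relabel_translate hTI, Matrix.trace_mul_comm ρ, ← trace_mul_fermionPartialTrace,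
    Matrix.trace_mul_comm]

end Torus

/-! ### §3. Hermiticity of weighted clusters; the structured annihilator of local consistency -/

section Annihilator

variable {d : ℕ}

/-- A finite sum of Hermitian matrices is Hermitian. [folklore] -/
private theorem isHermitian_sum_of_forall {κ n : Type*} [Fintype n] (s : Finset κ) {f : κ → Matrix n n ℂ}
    (hf : ∀ k ∈ s, (f k).IsHermitian) : (∑ k ∈ s, f k).IsHermitian := by
  unfold Matrix.IsHermitian
  rw [Matrix.conjTranspose_sum]
  exact Finset.sum_congr rfl fun k hk => (hf k hk).eq

/-- The kinetic term of a window bond is Hermitian (`X + Xᴴ` form). [cite: LiebPRL1989, eq. (1)] -/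
theorem isHermitian_clusterBondKinetic (Λ : Finset (Site d)) (y : PolySite Λ) (i : Fin d) :
    (clusterBondKinetic Λ y i).IsHermitian := by
  unfold clusterBondKinetic
  split_ifs with h
  · refine isHermitian_sum_of_forall _ fun σ _ => ?_
    have hX : creation (orb (PolySite.pt (ofLex y.1 + unitVec i) h) σ) * annihilation (orb y σ) =
        (creation (orb y σ) * annihilation (orb (PolySite.pt (ofLex y.1 + unitVec i) h) σ) :
          FermionOp Λ)ᴴ := by
      simp only [creation, Matrix.conjTranspose_mul, Matrix.conjTranspose_conjTranspose]
    rw [hX]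
    exact Matrix.isHermitian_add_transpose_self _
  · exact Matrix.isHermitian_zero

/-- `n_{y↑} n_{y↓}` is Hermitian (commuting Hermitian projections). [cite: LiebPRL1989, eq. (1)] -/
theorem isHermitian_numberOp_mul_numberOp {ι : Type*} [LinearOrder ι] [Fintype ι] (x : ι) :
    (numberOp x 0 * numberOp x 1 : Matrix (Finset (Orb ι)) (Finset (Orb ι)) ℂ).IsHermitian := by
  unfold Matrix.IsHermitian
  rw [Matrix.conjTranspose_mul]
  change (numberAt (orb x 1))ᴴ * (numberAt (orb x 0))ᴴ = _
  rw [(numberAt_isHermitian _).eq, (numberAt_isHermitian _).eq]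
  exact (numberAt_commute _ _).eq

/-- `n_{y↑} + n_{y↓}` is Hermitian. [cite: Tasaki2020, §9.2] -/
theorem isHermitian_numberOp_add_numberOp {ι : Type*} [LinearOrder ι] [Fintype ι] (x : ι) :
    (numberOp x 0 + numberOp x 1 : Matrix (Finset (Orb ι)) (Finset (Orb ι)) ℂ).IsHermitian := by
  change (numberAt (orb x 0) + numberAt (orb x 1)).IsHermitian
  exact (numberAt_isHermitian _).add (numberAt_isHermitian _)

/-- **The weighted cluster Hamiltonian is Hermitian** (real weights). [cite: Anderson1951, eq. (2)] -/
theorem isHermitian_clusterHamiltonian (Λ : Finset (Site d)) (t U : ℝ) (J : Site d → Fin d → ℝ)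
    (V μ' : Site d → ℝ) : (clusterHamiltonian Λ t U J V μ').IsHermitian := by
  unfold clusterHamiltonian
  refine Matrix.IsHermitian.add (Matrix.IsHermitian.add ?_ ?_) ?_
  · rw [← Complex.ofReal_neg]
    exact isHermitian_real_smul (isHermitian_sum_of_forall _ fun y _ =>
      isHermitian_sum_of_forall _ fun i _ => isHermitian_real_smul (isHermitian_clusterBondKinetic Λ y i) _) _
  · exact isHermitian_real_smul (isHermitian_sum_of_forall _ fun y _ =>
      isHermitian_real_smul (isHermitian_numberOp_mul_numberOp y) _) _
  · exact isHermitian_sum_of_forall _ fun y _ => isHermitian_real_smul (isHermitian_numberOp_add_numberOp y) _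

/-- **The structured annihilator** of the window `Λ`: a finite real combination
`G = Σ_{i ∈ s} g_i · (Γ(incl) O_i − Γ(incl)(Γ(τ_{z_i}) O_i))` of differences between a local operator
`O_i ∈ 𝔄_{S_i}` (`S_i ⊆ Λ`) and its translate by `z_i` (`S_i + z_i ⊆ Λ`) — the multipliers of the
local-consistency constraints of a translation-invariant state (`tr ρ_Λ O = tr ρ_Λ τ_z O`). Its expectation
vanishes in every translation-invariant torus state (`trace_window_mul_windowAnnihilator`), so adding it to
the energy representative changes no expectation while tightening the certificate.
[cite: PoulinHastings2011, eqs. (3)–(8)] -/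
def windowAnnihilator {ι : Type*} (s : Finset ι) (Λ : Finset (Site d)) (S : ι → Finset (Site d))
    (hS : ∀ i, S i ⊆ Λ) (z : ι → Site d) (hz : ∀ i, shiftSet (z i) (S i) ⊆ Λ)
    (O : ∀ i, FermionOp (S i)) (g : ι → ℝ) : FermionOp Λ :=
  ∑ i ∈ s, ((g i : ℝ) : ℂ) • (fermionEmbed (PolySite.incl (hS i)) (O i) -
    fermionEmbed (PolySite.incl (hz i)) (fermionEmbed (PolySite.shiftEmb (z i) (S i)) (O i)))

/-- The structured annihilator is Hermitian when its local operators are. [cite: PoulinHastings2011, eqs. (3)–(8)] -/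
theorem isHermitian_windowAnnihilator {ι : Type*} (s : Finset ι) (Λ : Finset (Site d))
    (S : ι → Finset (Site d)) (hS : ∀ i, S i ⊆ Λ) (z : ι → Site d) (hz : ∀ i, shiftSet (z i) (S i) ⊆ Λ)
    {O : ∀ i, FermionOp (S i)} (hO : ∀ i ∈ s, (O i).IsHermitian) (g : ι → ℝ) :
    (windowAnnihilator s Λ S hS z hz O g).IsHermitian := by
  unfold windowAnnihilator
  refine isHermitian_sum_of_forall _ fun i hi => isHermitian_real_smul (Matrix.IsHermitian.sub ?_ ?_) _
  · unfold Matrix.IsHermitian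
    rw [← fermionEmbed_conjTranspose, (hO i hi).eq]
  · unfold Matrix.IsHermitian
    rw [← fermionEmbed_conjTranspose, ← fermionEmbed_conjTranspose, (hO i hi).eq]

variable {L : ℕ} [NeZero L]

/-- (Local, as in §1.) [folklore] -/
local instance (priority := high) instDecidableEqFermionTorusClusterRep' : DecidableEq (FermionTorus d L) :=
  LinearOrder.toDecidableEq

/-- **The annihilator has zero expectation in every translation-invariant torus state**:
`tr(ρ_Λ · G) = 0` for `ρ_Λ = tr_{𝕋→Λ} ρ`, `Λ` fitting into the torus (termwise
`torus_trace_fermionPartialTrace_mul_translate_eq`). This discharges the hypothesis `hG0` of the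
certificate theorems for every structured annihilator. [cite: ArakiMoriya2003, §4.1 Def. 4.5] -/
theorem trace_window_mul_windowAnnihilator
    {ρ : Matrix (Finset (Orb (FermionTorus d L))) (Finset (Orb (FermionTorus d L))) ℂ}
    (hTI : ∀ w : TorusSite d L, relabel (Orb.translate w) ρ = ρ)
    {Λ : Finset (Site d)} (hΩ : Set.InjOn (Torus.proj (d := d) L) ↑Λ)
    {ι : Type*} (s : Finset ι) (S : ι → Finset (Site d)) (hS : ∀ i, S i ⊆ Λ) (z : ι → Site d)
    (hz : ∀ i, shiftSet (z i) (S i) ⊆ Λ) (O : ∀ i, FermionOp (S i)) (g : ι → ℝ) :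
    (fermionPartialTrace (PolySite.toTorusEmb L hΩ) ρ * windowAnnihilator s Λ S hS z hz O g).trace = 0 := by
  unfold windowAnnihilator
  rw [Matrix.mul_sum, Matrix.trace_sum]
  refine Finset.sum_eq_zero fun i _ => ?_
  rw [Matrix.mul_smul, Matrix.trace_smul, Matrix.mul_sub, Matrix.trace_sub,
    torus_trace_fermionPartialTrace_mul_translate_eq hTI hΩ (hS i) (z i) (hz i) (O i), sub_self, smul_zero]

end Annihilator

end Literature.MathematicalPhysics.QuantumLattice

end
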